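import Literature.NumberTheory.Transcendental.BakerLogarithmsConclusion

/-!
# `NormalFormPrinciple` (stmt-KontsevichZagierPeriods-3869), line `SketchIdeator1` — the Baker
# endgame `eq_zero_of_alg_add_sum_mul_log_eq_zero` (siege attempt k8: certificate / finite core)

Pure proof file (`--supports` the crux stmt-KontsevichZagierPeriods-3869), no definitions. It proves
the registered sub-goal

* `eq_zero_of_alg_add_sum_mul_log_eq_zero`: if `ε₁, …, ε_s > 0` are real algebraic numbers whose
  logarithms are `ℚ`-linearly independent and `r + Σᵢ Cᵢ log εᵢ = 0` with real ALGEBRAIC `r, Cᵢ`,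
  then `r = 0` and every `Cᵢ = 0`

of the algebraic-pole layer of the leaf `stub_boxRigidity` (values `r + Σ Cⱼ log aⱼ` of
one-dimensional rational integral representations with real algebraic poles).

Organisation of the proof ("certificate, then decide on the finite core"):

1. `linearIndependent_algebraicClosure_one_log` — the TRANSCENDENCE input enters exactly once:
   Baker's theorem in its printed, finitely indexed form
   (`Literature.NumberTheory.Transcendental.bakerFin_holds`, Baker 1975, Thm. 2.1, proved in the
   tree) is instantiated at the real logarithms `log εᵢ` (complexified: `e^{log εᵢ} = εᵢ` is
   algebraic, and `ℚ`-independence transfers along `re ∘ ofReal = id`). Its output is a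
   CERTIFICATE: the finite family `1, log ε₁, …, log ε_s ∈ ℂ`, indexed by `Option (Fin s)`, is
   linearly independent over `ℚ̄ = algebraicClosure ℚ ℂ`.
2. `eq_zero_of_linearIndependent_option_elim` — pure finite-dimensional linear algebra, no
   analysis: against such a certificate a single finite relation `a • u + Σᵢ cᵢ • vᵢ = 0` has all
   coefficients zero (`Fintype.linearIndependent_iff`, the `Option`-indexed sum split by
   `Fintype.sum_option`).
3. The registered statement: read the real relation in `ℂ` with coefficients in `ℚ̄` and apply
   2 to 1.

Sources: A. Baker, *Transcendental Number Theory* (1975), Theorem 2.1; M. Kontsevich, D. Zagier,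
*Periods* (2001), §1.2 (the role of such relations among logarithms in Conjecture 1).
-/

noncomputable section

namespace Summit.KontsevichZagierPeriods.HurwitzMicroSectors.NormalFormPrinciple.PiBox.Dlog.SiegeK8

/-! ## The finite core -/

/-- **Finite core.** If the finite family `u, v₁, …, vₙ` (indexed by `Option ι`, `none ↦ u`) is
linearly independent over `K`, then a relation `a • u + Σᵢ cᵢ • vᵢ = 0` with coefficients in `K`
has `a = 0` and every `cᵢ = 0`. [folklore] -/
theorem eq_zero_of_linearIndependent_option_elim {K V ι : Type*} [Ring K] [AddCommGroup V]
    [Module K V] [Fintype ι] {u : V} {v : ι → V}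
    (hli : LinearIndependent K fun o : Option ι => o.elim u v)
    (a : K) (c : ι → K) (h : a • u + ∑ i, c i • v i = 0) : a = 0 ∧ ∀ i, c i = 0 := by
  have h0 : ∀ o, Option.elim o a c = 0 :=
    Fintype.linearIndependent_iff.mp hli (fun o => o.elim a c) (by
      rw [Fintype.sum_option]
      simpa only [Option.elim_none, Option.elim_some] using h)
  exact ⟨h0 none, fun i => h0 (some i)⟩

/-! ## The certificate: Baker's theorem at real logarithms -/

/-- **Baker's certificate for real logarithms.** For positive real algebraic `ε₁, …, ε_s` with
`ℚ`-linearly independent logarithms, the finite family `1, log ε₁, …, log ε_s` of complex numbers is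
linearly independent over the field `ℚ̄ = algebraicClosure ℚ ℂ` of all algebraic numbers
(Baker's Theorem 2.1 with `lᵢ = log εᵢ`, `e^{lᵢ} = εᵢ`). [cite: Baker1975, Theorem 2.1] -/
theorem linearIndependent_algebraicClosure_one_log {s : ℕ} (ε : Fin s → ℝ) (hε : ∀ i, 0 < ε i)
    (hεalg : ∀ i, IsAlgebraic ℚ (ε i)) (hli : LinearIndependent ℚ (fun i => Real.log (ε i))) :
    LinearIndependent (algebraicClosure ℚ ℂ)
      fun o : Option (Fin s) => o.elim (1 : ℂ) fun i => ((Real.log (ε i) : ℝ) : ℂ) := by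
  refine Literature.NumberTheory.Transcendental.bakerFin_holds s _ (fun i => ?_) ?_
  · -- `e^{log εᵢ} = εᵢ` is algebraic
    rw [← Complex.ofReal_exp, Real.exp_log (hε i)]
    exact (hεalg i).algebraMap
  · -- `ℚ`-independence survives complexification, `re ∘ ofReal = id`
    refine LinearIndependent.of_comp (Complex.reLm.restrictScalars ℚ) ?_
    have hcomp : ⇑(Complex.reLm.restrictScalars ℚ) ∘ (fun i => ((Real.log (ε i) : ℝ) : ℂ)) =
        fun i => Real.log (ε i) := by
      funext i
      simp
    rw [hcomp]
    exact hli

/-! ## The registered sub-goal -/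

/-- **Baker, torsion-free form used by the moves** (registered sub-goal
`eq_zero_of_alg_add_sum_mul_log_eq_zero` of crux stmt-KontsevichZagierPeriods-3869). If
`ε₁, …, ε_s > 0` are real algebraic with `ℚ`-linearly independent logarithms and
`r + Σᵢ Cᵢ log εᵢ = 0` with real ALGEBRAIC `r, Cᵢ`, then `r = 0` and every `Cᵢ = 0`: the relation,
read in `ℂ` with its coefficients in `ℚ̄`, is a finite relation against Baker's certificate
(`linearIndependent_algebraicClosure_one_log`), so the finite core
(`eq_zero_of_linearIndependent_option_elim`) kills every coefficient.
[cite: Baker1975, Theorem 2.1] -/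
theorem eq_zero_of_alg_add_sum_mul_log_eq_zero {s : ℕ} (ε : Fin s → ℝ) (hε : ∀ i, 0 < ε i)
    (hεalg : ∀ i, IsAlgebraic ℚ (ε i)) (hli : LinearIndependent ℚ (fun i => Real.log (ε i)))
    (r : ℝ) (hr : IsAlgebraic ℚ r) (C : Fin s → ℝ) (hC : ∀ i, IsAlgebraic ℚ (C i))
    (h : r + ∑ i, C i * Real.log (ε i) = 0) : r = 0 ∧ ∀ i, C i = 0 := by
  -- real algebraic numbers, complexified, are elements of `ℚ̄ ⊂ ℂ`
  have hmem : ∀ x : ℝ, IsAlgebraic ℚ x → (x : ℂ) ∈ algebraicClosure ℚ ℂ := fun x hx =>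
    mem_algebraicClosure_iff.mpr hx.algebraMap
  -- the relation, read in `ℂ`
  have hC' : (r : ℂ) * 1 + ∑ i, (C i : ℂ) * ((Real.log (ε i) : ℝ) : ℂ) = 0 := by
    rw [mul_one]
    exact_mod_cast congrArg (fun t : ℝ => (t : ℂ)) h
  -- decide on the finite core against Baker's certificate
  obtain ⟨hr0, hC0⟩ := eq_zero_of_linearIndependent_option_elim
    (linearIndependent_algebraicClosure_one_log ε hε hεalg hli)
    (⟨(r : ℂ), hmem r hr⟩ : algebraicClosure ℚ ℂ) (fun i => ⟨(C i : ℂ), hmem (C i) (hC i)⟩) hC'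
  exact ⟨Complex.ofReal_eq_zero.mp (congrArg Subtype.val hr0),
    fun i => Complex.ofReal_eq_zero.mp (congrArg Subtype.val (hC0 i))⟩

end Summit.KontsevichZagierPeriods.HurwitzMicroSectors.NormalFormPrinciple.PiBox.Dlog.SiegeK8
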